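import Summits.CriticalPhenomena.PercolationContinuityZ3.Theorems.PercNearOneGluingNoHeavyLowerTailQ7PsiMonotone
import Literature.Probability.Percolation.KozmaNitzanSmallClusters
import HarnessLib

/-!
# `NoHeavyLowerTail` (stmt-CriticalPhenomena-4575) — the peeled form of Question 7 on the star class,
# auxiliary file: clusters under the star events `σ_B` of the observer

Support file (`--supports stmt-CriticalPhenomena-4575`), coupling seat `prim-cplus-coupling` (gen 5).  No
definitions, no named facts, no sorries.

Setting (seat memo A5-COUPLING-gen5.md §9–§10): a finite weighted graph on `V`, an observer `o` all of whose
edges go to the three relays `x, y, z` (Kozma–Nitzan's Theorem-4 class, arXiv:2401.12397 pp. 12–14), a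
monotone function `F` of vertex sets (a monotone cluster property, §5.1 p. 31).  Conditioning on the star
`σ_B` of `o` (the open pairs at `o` are exactly those to `B ⊆ {x,y,z}`; `KNPreFKG.starEvent`), the
clusters of `o, x, z` are expressed through the clusters OFF `o` (`{v | ω ∈ openConnIn {o}ᶜ a v}`), and the
two integrands of the main file — `𝟙_J (F(C(o)) − F(C(z)))` with `J = {o ↔ x} ∪ {o ↔ y}`, and
`𝟙_J (F(C(o)) − F(C(z))) − (F(C(x)) − F(C(z)))` — are bounded below on each star by functions of the
configuration off `o`:

* `Q7Psi.Star.openCluster_o`, `openCluster_of_off`, `openCluster_of_on` — the clusters under `σ_B` (two-sided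
  versions of the tree's `KNPreFKG.openCluster_subset_*_of_starEvent`, with `KNPreFKG.reachable_center_iff_of_mem_starEvent`);
* `Q7Psi.Star.psiIntegrand_*` — the first integrand is `0` under `σ_∅` and under every star containing `z`,
  and at least `F(X') − F(Z')`, `F(Y') − F(Z')`, `𝟙{z ∉ X'∪Y'}(F(X'∪Y') − F(Z'))` under `σ_{x}`, `σ_{y}`,
  `σ_{x,y}` (`X', Y', Z'` the clusters of `x, y, z` off `o`);
* `Q7Psi.Star.diffIntegrand_*` — the second integrand equals `−(F(X') − F(Z'))` under `σ_∅`, vanishes under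
  every star containing `x`, and is at least `F(Y') − F(X')`, `−(F(X') − F(Z'))`,
  `−𝟙{x ∉ Y'∪Z'}(F(X') − F(Z'))` under `σ_{y}`, `σ_{z}`, `σ_{y,z}`.
[cite: KozmaNitzan2024, Lemma 5 (p. 13), Theorem 4 (pp. 12–14), §5.1 (pp. 31–32)]
-/

namespace Summit.CriticalPhenomena.PercolationContinuityZ3.Theorems

open MeasureTheory Set Literature.Probability.LatticeModels Literature.Probability.Percolation
open scoped Classical
open KNPreFKG

noncomputable section

namespace Q7Psi.Star

variable {V : Type*}

/-! ### Clusters under the star event `σ_B` -/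

/-- Under `σ_B` the cluster of `o` is `{o}` together with the vertices joined off `o` to `B ∖ {o}`.
[cite: KozmaNitzan2024, Lemma 5 (p. 13)] -/
theorem openCluster_o {ω : BondConfig V} {o : V} {B : Set V} (hσ : ω ∈ starEvent o B) :
    openCluster ω o = {o} ∪ {v | ∃ u ∈ B, u ≠ o ∧ ω ∈ openConnIn ({o}ᶜ : Set V) u v} := by
  refine Subset.antisymm ?_ (insert_offClusterOf_subset_openCluster hσ)
  intro v hv
  by_cases hvo : v = o
  · exact Or.inl hvo
  · obtain ⟨p⟩ := (hv : (openGraph ω).Reachable o v)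
    exact Or.inr ((walk_decomp hσ p hvo).2 rfl)

/-- Under `σ_B`, a vertex `a ≠ o` not joined off `o` to `B ∖ {o}` has as cluster its cluster off `o`.
[cite: KozmaNitzan2024, Lemma 5 (p. 13)] -/
theorem openCluster_of_off {ω : BondConfig V} {o : V} {B : Set V} (hσ : ω ∈ starEvent o B) {a : V}
    (hao : a ≠ o) (hn : ∀ u ∈ B, u ≠ o → ω ∉ openConnIn ({o}ᶜ : Set V) a u) :
    openCluster ω a = {v | ω ∈ openConnIn ({o}ᶜ : Set V) a v} :=
  Subset.antisymm (openCluster_subset_off_of_starEvent hσ hao hn) fun _ hv => reachable_of_openConnIn hv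

/-- Under `σ_B`, a vertex `a ≠ o` joined off `o` to some `u ∈ B ∖ {o}` has the same cluster as `o`.
[cite: KozmaNitzan2024, Lemma 5 (p. 13)] -/
theorem openCluster_of_on {ω : BondConfig V} {o : V} {B : Set V} (hσ : ω ∈ starEvent o B) {a u : V}
    (huB : u ∈ B) (huo : u ≠ o) (hau : ω ∈ openConnIn ({o}ᶜ : Set V) a u) :
    openCluster ω a = openCluster ω o := by
  have ha : a ∈ openCluster ω o := by
    refine insert_offClusterOf_subset_openCluster hσ (Or.inr ⟨u, huB, huo, ?_⟩)
    rw [openConnIn_comm]; exact hau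
  exact (openCluster_eq_of_reachable (ha : (openGraph ω).Reachable o a)).symm

/-- Off-`o` connection events are symmetric and transitive, so "`a` is joined off `o` to `b`" transfers
the off-`o` cluster: if `ω ∈ openConnIn {o}ᶜ a b` then the off-`o` clusters of `a` and `b` coincide. [folklore] -/
theorem offCluster_eq_of_openConnIn {ω : BondConfig V} {o a b : V} (h : ω ∈ openConnIn ({o}ᶜ : Set V) a b) :
    {v | ω ∈ openConnIn ({o}ᶜ : Set V) a v} = {v | ω ∈ openConnIn ({o}ᶜ : Set V) b v} := by
  ext v
  constructor
  · intro hv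
    have h' : ω ∈ openConnIn ({o}ᶜ : Set V) b a := by rw [openConnIn_comm]; exact h
    exact openConnIn_trans h' hv
  · intro hv
    exact openConnIn_trans h hv

/-! ### The two integrands under the eight stars `σ_B`, `B ⊆ {x, y, z}` -/

section Integrands

variable {o x y z : V}

/-- Under `σ_{x}`: `F(C(o)) − F(C(z)) ≥ F(X') − F(Z')`, and `o ↔ x`. [cite: KozmaNitzan2024, Lemma 5 (p. 13)] -/
theorem psiIntegrand_x (F : Set V → ℝ) (hF : ∀ S T : Set V, S ⊆ T → F S ≤ F T)
    {ω : BondConfig V} (hσ : ω ∈ starEvent o ({x} : Set V)) (hxo : x ≠ o) (hzo : z ≠ o) :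
    F {v | ω ∈ openConnIn ({o}ᶜ : Set V) x v} - F {v | ω ∈ openConnIn ({o}ᶜ : Set V) z v} ≤ F (openCluster ω o) - F (openCluster ω z) ∧
      (openGraph ω).Reachable o x := by
  have hox : (openGraph ω).Reachable o x :=
    (reachable_center_iff_of_mem_starEvent hσ hxo).2 ⟨x, rfl, hxo, openConnIn_rfl (mem_compl_singleton_iff.2 hxo) ω⟩
  refine ⟨?_, hox⟩
  have hCo : openCluster ω o = openCluster ω x := openCluster_eq_of_reachable hox
  by_cases hzx : ω ∈ openConnIn ({o}ᶜ : Set V) z x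
  · -- `z` joined to `x` off `o`: both differences vanish
    rw [openCluster_of_on hσ rfl hxo hzx, offCluster_eq_of_openConnIn hzx]
    simp
  · have hn : ∀ u ∈ ({x} : Set V), u ≠ o → ω ∉ openConnIn ({o}ᶜ : Set V) z u := by
      intro u hu _; rw [mem_singleton_iff.1 hu]; exact hzx
    rw [openCluster_of_off hσ hzo hn, hCo,
      openCluster_of_on hσ rfl hxo (openConnIn_rfl (mem_compl_singleton_iff.2 hxo) ω), openCluster_o hσ]
    have hsub : {v | ω ∈ openConnIn ({o}ᶜ : Set V) x v} ⊆ {o} ∪ {v | ∃ u ∈ ({x} : Set V), u ≠ o ∧ ω ∈ openConnIn ({o}ᶜ : Set V) u v} :=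
      fun v hv => Or.inr ⟨x, rfl, hxo, hv⟩
    linarith [hF _ _ hsub]

/-- Under `σ_{x,y}`: `F(C(o)) − F(C(z)) ≥ 𝟙{z ∉ X' ∪ Y'}·(F(X' ∪ Y') − F(Z'))`, and `o ↔ x`.
[cite: KozmaNitzan2024, Lemma 5 (p. 13)] -/
theorem psiIntegrand_xy (F : Set V → ℝ) (hF : ∀ S T : Set V, S ⊆ T → F S ≤ F T)
    {ω : BondConfig V} (hσ : ω ∈ starEvent o ({x, y} : Set V)) (hxo : x ≠ o) (hyo : y ≠ o)
    (hzo : z ≠ o) :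
    (if ω ∈ openConnIn ({o}ᶜ : Set V) z x ∨ ω ∈ openConnIn ({o}ᶜ : Set V) z y then (0 : ℝ)
      else F ({v | ω ∈ openConnIn ({o}ᶜ : Set V) x v} ∪ {v | ω ∈ openConnIn ({o}ᶜ : Set V) y v}) -
          F {v | ω ∈ openConnIn ({o}ᶜ : Set V) z v}) ≤
        F (openCluster ω o) - F (openCluster ω z) ∧ (openGraph ω).Reachable o x := by
  have hox : (openGraph ω).Reachable o x :=
    (reachable_center_iff_of_mem_starEvent hσ hxo).2 ⟨x, Or.inl rfl, hxo, openConnIn_rfl (mem_compl_singleton_iff.2 hxo) ω⟩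
  refine ⟨?_, hox⟩
  by_cases hz : ω ∈ openConnIn ({o}ᶜ : Set V) z x ∨ ω ∈ openConnIn ({o}ᶜ : Set V) z y
  · rw [if_pos hz]
    rcases hz with h | h
    · rw [openCluster_of_on hσ (Or.inl rfl) hxo h]; simp
    · rw [openCluster_of_on hσ (Or.inr rfl) hyo h]; simp
  · rw [if_neg hz]
    push Not at hz
    have hn : ∀ u ∈ ({x, y} : Set V), u ≠ o → ω ∉ openConnIn ({o}ᶜ : Set V) z u := by
      intro u hu _
      rcases hu with rfl | rfl
      · exact hz.1
      · exact hz.2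
    rw [openCluster_of_off hσ hzo hn, openCluster_o hσ]
    have hsub : {v | ω ∈ openConnIn ({o}ᶜ : Set V) x v} ∪ {v | ω ∈ openConnIn ({o}ᶜ : Set V) y v} ⊆
        {o} ∪ {v | ∃ u ∈ ({x, y} : Set V), u ≠ o ∧ ω ∈ openConnIn ({o}ᶜ : Set V) u v} := by
      rintro v (hv | hv)
      · exact Or.inr ⟨x, Or.inl rfl, hxo, hv⟩
      · exact Or.inr ⟨y, Or.inr rfl, hyo, hv⟩
    linarith [hF _ _ hsub]

/-- Under a star containing `z`: `F(C(o)) − F(C(z)) = 0`. [cite: KozmaNitzan2024, Lemma 5 (p. 13)] -/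
theorem psiIntegrand_z (F : Set V → ℝ)
    {ω : BondConfig V} {B : Set V} (hσ : ω ∈ starEvent o B) (hzB : z ∈ B) (hzo : z ≠ o) :
    F (openCluster ω o) - F (openCluster ω z) = 0 := by
  rw [openCluster_of_on hσ hzB hzo (openConnIn_rfl (mem_compl_singleton_iff.2 hzo) ω), sub_self]

/-- Under `σ_∅`: `o` is joined to no other vertex. [cite: KozmaNitzan2024, Lemma 5 (p. 13)] -/
theorem not_reachable_of_empty {ω : BondConfig V} (hσ : ω ∈ starEvent o (∅ : Set V)) {a : V} (hao : a ≠ o) :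
    ¬ (openGraph ω).Reachable o a := by
  rw [reachable_center_iff_of_mem_starEvent hσ hao]
  rintro ⟨u, hu, -, -⟩
  exact hu

/-- Under `σ_∅`: the second integrand is `−(F(X') − F(Z'))` (the first vanishes, the clusters of `x, z` are their
clusters off `o`). [cite: KozmaNitzan2024, Lemma 5 (p. 13)] -/
theorem diffIntegrand_empty (F : Set V → ℝ)
    {ω : BondConfig V} (hσ : ω ∈ starEvent o (∅ : Set V)) (hxo : x ≠ o) (hzo : z ≠ o) :
    F (openCluster ω x) - F (openCluster ω z) = F {v | ω ∈ openConnIn ({o}ᶜ : Set V) x v} - F {v | ω ∈ openConnIn ({o}ᶜ : Set V) z v} := by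
  rw [openCluster_of_off hσ hxo (fun u hu _ => absurd hu (notMem_empty u)),
    openCluster_of_off hσ hzo (fun u hu _ => absurd hu (notMem_empty u))]

/-- Under a star containing `x`: `C(x) = C(o)` (so the second integrand vanishes on `J`).
[cite: KozmaNitzan2024, Lemma 5 (p. 13)] -/
theorem openCluster_x_of_mem {ω : BondConfig V} {B : Set V} (hσ : ω ∈ starEvent o B) (hxB : x ∈ B) (hxo : x ≠ o) :
    openCluster ω x = openCluster ω o ∧ (openGraph ω).Reachable o x := by
  refine ⟨openCluster_of_on hσ hxB hxo (openConnIn_rfl (mem_compl_singleton_iff.2 hxo) ω), ?_⟩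
  exact (reachable_center_iff_of_mem_starEvent hσ hxo).2 ⟨x, hxB, hxo, openConnIn_rfl (mem_compl_singleton_iff.2 hxo) ω⟩

/-- Under `σ_{y}`: the second integrand `(F(C(o)) − F(C(z))) − (F(C(x)) − F(C(z))) = F(C(o)) − F(C(x))` is at least
`F(Y') − F(X')`, and `o ↔ y`. [cite: KozmaNitzan2024, Lemma 5 (p. 13)] -/
theorem diffIntegrand_y (F : Set V → ℝ) (hF : ∀ S T : Set V, S ⊆ T → F S ≤ F T)
    {ω : BondConfig V} (hσ : ω ∈ starEvent o ({y} : Set V)) (hxo : x ≠ o) (hyo : y ≠ o) :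
    F {v | ω ∈ openConnIn ({o}ᶜ : Set V) y v} - F {v | ω ∈ openConnIn ({o}ᶜ : Set V) x v} ≤ F (openCluster ω o) - F (openCluster ω x) ∧
      (openGraph ω).Reachable o y := by
  have hoy : (openGraph ω).Reachable o y :=
    (reachable_center_iff_of_mem_starEvent hσ hyo).2 ⟨y, rfl, hyo, openConnIn_rfl (mem_compl_singleton_iff.2 hyo) ω⟩
  refine ⟨?_, hoy⟩
  by_cases hxy : ω ∈ openConnIn ({o}ᶜ : Set V) x y
  · rw [openCluster_of_on hσ rfl hyo hxy, offCluster_eq_of_openConnIn hxy]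
    simp
  · have hn : ∀ u ∈ ({y} : Set V), u ≠ o → ω ∉ openConnIn ({o}ᶜ : Set V) x u := by
      intro u hu _; rw [mem_singleton_iff.1 hu]; exact hxy
    rw [openCluster_of_off hσ hxo hn, openCluster_o hσ]
    have hsub : {v | ω ∈ openConnIn ({o}ᶜ : Set V) y v} ⊆ {o} ∪ {v | ∃ u ∈ ({y} : Set V), u ≠ o ∧ ω ∈ openConnIn ({o}ᶜ : Set V) u v} :=
      fun v hv => Or.inr ⟨y, rfl, hyo, hv⟩
    linarith [hF _ _ hsub]

/-- Under `σ_{z}`: `C(o) = C(z)` and `F(C(x)) − F(C(z)) ≤ F(X') − F(Z')`. [cite: KozmaNitzan2024, Lemma 5 (p. 13)] -/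
theorem diffIntegrand_z (F : Set V → ℝ) (hF : ∀ S T : Set V, S ⊆ T → F S ≤ F T)
    {ω : BondConfig V} (hσ : ω ∈ starEvent o ({z} : Set V)) (hxo : x ≠ o) (hzo : z ≠ o) :
    F (openCluster ω x) - F (openCluster ω z) ≤ F {v | ω ∈ openConnIn ({o}ᶜ : Set V) x v} - F {v | ω ∈ openConnIn ({o}ᶜ : Set V) z v} ∧
      openCluster ω o = openCluster ω z := by
  have hCz : openCluster ω z = openCluster ω o :=
    openCluster_of_on hσ rfl hzo (openConnIn_rfl (mem_compl_singleton_iff.2 hzo) ω)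
  refine ⟨?_, hCz.symm⟩
  by_cases hxz : ω ∈ openConnIn ({o}ᶜ : Set V) x z
  · rw [openCluster_of_on hσ rfl hzo hxz, hCz, offCluster_eq_of_openConnIn hxz]
    simp
  · have hn : ∀ u ∈ ({z} : Set V), u ≠ o → ω ∉ openConnIn ({o}ᶜ : Set V) x u := by
      intro u hu _; rw [mem_singleton_iff.1 hu]; exact hxz
    rw [openCluster_of_off hσ hxo hn, hCz, openCluster_o hσ]
    have hsub : {v | ω ∈ openConnIn ({o}ᶜ : Set V) z v} ⊆ {o} ∪ {v | ∃ u ∈ ({z} : Set V), u ≠ o ∧ ω ∈ openConnIn ({o}ᶜ : Set V) u v} :=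
      fun v hv => Or.inr ⟨z, rfl, hzo, hv⟩
    linarith [hF _ _ hsub]

/-- Under `σ_{y,z}`: `C(o) = C(z)` and `F(C(x)) − F(C(z)) ≤ 𝟙{x ∉ Y' ∪ Z'}·(F(X') − F(Z'))`.
[cite: KozmaNitzan2024, Lemma 5 (p. 13)] -/
theorem diffIntegrand_yz (F : Set V → ℝ) (hF : ∀ S T : Set V, S ⊆ T → F S ≤ F T)
    {ω : BondConfig V} (hσ : ω ∈ starEvent o ({y, z} : Set V)) (hxo : x ≠ o) (hyo : y ≠ o)
    (hzo : z ≠ o) :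
    F (openCluster ω x) - F (openCluster ω z) ≤
      (if ω ∈ openConnIn ({o}ᶜ : Set V) x y ∨ ω ∈ openConnIn ({o}ᶜ : Set V) x z then (0 : ℝ)
        else F {v | ω ∈ openConnIn ({o}ᶜ : Set V) x v} - F {v | ω ∈ openConnIn ({o}ᶜ : Set V) z v}) ∧
      openCluster ω o = openCluster ω z := by
  have hCz : openCluster ω z = openCluster ω o :=
    openCluster_of_on hσ (Or.inr rfl) hzo (openConnIn_rfl (mem_compl_singleton_iff.2 hzo) ω)
  refine ⟨?_, hCz.symm⟩
  by_cases hx : ω ∈ openConnIn ({o}ᶜ : Set V) x y ∨ ω ∈ openConnIn ({o}ᶜ : Set V) x z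
  · rw [if_pos hx]
    rcases hx with h | h
    · rw [openCluster_of_on hσ (Or.inl rfl) hyo h, hCz]; simp
    · rw [openCluster_of_on hσ (Or.inr rfl) hzo h, hCz]; simp
  · rw [if_neg hx]
    push Not at hx
    have hn : ∀ u ∈ ({y, z} : Set V), u ≠ o → ω ∉ openConnIn ({o}ᶜ : Set V) x u := by
      intro u hu _
      rcases hu with rfl | rfl
      · exact hx.1
      · exact hx.2
    rw [openCluster_of_off hσ hxo hn, hCz, openCluster_o hσ]
    have hsub : {v | ω ∈ openConnIn ({o}ᶜ : Set V) z v} ⊆ {o} ∪ {v | ∃ u ∈ ({y, z} : Set V), u ≠ o ∧ ω ∈ openConnIn ({o}ᶜ : Set V) u v} :=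
      fun v hv => Or.inr ⟨z, Or.inr rfl, hzo, hv⟩
    linarith [hF _ _ hsub]

end Integrands

end Q7Psi.Star

end

end Summit.CriticalPhenomena.PercolationContinuityZ3.Theorems
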